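import Summits.RiemannHypothesis.RiemannHypothesis.Theorems.WeilFormatCWindowGram
import Summits.RiemannHypothesis.RiemannHypothesis.Theorems.WeilFormatCSectorSplit
import HarnessLib

/-!
# Format C (Fourier–Galerkin certificates of Weil positivity): from REAL PSD certificates of the
  sector Gram matrices on the cos / sin bases to `WeilPositivityOn a`

Helper file (`--supports stmt-RiemannHypothesis-0098`, lead-track anchor), RH-free. Seat
rh-explicit-weil-3 (gen3). Sequel of `WeilFormatCWindowGram.lean`; objects `chiEven`, `chiOdd` of
`WeilFormatCDefs.lean` (the sector bases of FORMATC-DESIGN §1 (c1): `w⁺_0 = χ_0`,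
`w⁺_i = (χ_i + χ_{−i})/√2`, `w⁻_i = (χ_i − χ_{−i})/√2`).

This is the LAST glue between a format-C certificate as produced (per parity sector, a real symmetric
Gram matrix `G^± (i,j) = weilWindowSesq a w^±_i w^±_j`, `0 ≤ i, j ≤ N` resp. `1 ≤ i, j ≤ N`, shown PSD
for every `N` by block `LDLᵀ` + far coercivity + Schur complement) and the ladder:

* `isWindowFunction_chiEven / _chiOdd`: the sector bases are window functions (`modes_succ` is weil-2's,
  `WeilFormatCSectorSplit.lean`, which does the same split at the level of real kernels on `ℤ × ℤ`);
* `sum_modes_smul_chi_of_even / _of_odd`: an even (odd) trigonometric window is a combination of the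
  even (odd) sector basis: `Σ_{|n|≤N} c_n χ_n = Σ_{0≤i≤N} ζ_i w⁺_i`, `ζ_0 = c_0`, `ζ_i = √2 c_i`
  (resp. `= Σ_{1≤i≤N} √2 c_i w⁻_i`);
* `real_psd_of_subset`: principal sub-blocks of a PSD real Gram are PSD (one block certificate at
  size `M` covers every `N ≤ M`);
* **`weilPositivityOn_of_sectorBasis_real_gram_psd`**: if both sector Grams have real entries and
  `Σ_{i,j} z_i · Re G^±(i,j) · z_j ≥ 0` for every `N` and every real `z` (the quadratic-form shape of weil-10's
  `farBlock_ge_diag` / `schurStepDiag`), then `WeilPositivityOn a`.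
-/

set_option autoImplicit false
set_option linter.dupNamespace false  -- the mandated namespace repeats `RiemannHypothesis`

noncomputable section

open Complex Filter Set MeasureTheory
open scoped Real Topology ComplexConjugate

namespace Summit.RiemannHypothesis.RiemannHypothesis.Theorems.WeilFormatC

open Literature.NumberTheory.LFunctions
open Literature.NumberTheory.LFunctions.Yoshida1992 (modes chi mem_modes)

variable {a : ℝ}

/-! ## The sector bases are window functions -/

/-- `w⁺_i` is a window function (`a > 0`). -/
theorem isWindowFunction_chiEven (ha : 0 < a) (i : ℕ) : IsWindowFunction a (chiEven a i) := by
  unfold chiEven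
  split_ifs
  · exact isWindowFunction_chi ha 0
  · exact ((isWindowFunction_chi ha i).add (isWindowFunction_chi ha (-(i : ℤ)))).smul _

/-- `w⁻_i` is a window function (`a > 0`). -/
theorem isWindowFunction_chiOdd (ha : 0 < a) (i : ℕ) : IsWindowFunction a (chiOdd a i) := by
  unfold chiOdd
  have h : IsWindowFunction a (chi a (i : ℤ) - chi a (-(i : ℤ))) := by
    rw [sub_eq_add_neg, show -chi a (-(i : ℤ)) = (-1 : ℂ) • chi a (-(i : ℤ)) by simp]
    exact (isWindowFunction_chi ha i).add ((isWindowFunction_chi ha (-(i : ℤ))).smul _)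
  exact h.smul _

/-! ## Even / odd trigonometric windows on the sector bases -/

/-- `N + 1` is a new mode: `N+1 ∉ {−(N+1)} ∪ modes N`. -/
theorem not_mem_modes_succ_left (N : ℕ) : (N : ℤ) + 1 ∉ insert (-((N : ℤ) + 1)) (modes N) := by
  simp only [Finset.mem_insert, mem_modes, abs_le, not_or]
  omega

/-- `−(N + 1)` is a new mode: `−(N+1) ∉ modes N`. -/
theorem neg_succ_not_mem_modes (N : ℕ) : -((N : ℤ) + 1) ∉ modes N := by
  simp only [mem_modes, abs_le]
  omega

/-- `√2 · (1/√2) = 1` in `ℂ`. -/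
private theorem sqrt_two_mul_inv_sqrt_two :
    ((Real.sqrt 2 : ℝ) : ℂ) * ((1 / Real.sqrt 2 : ℝ) : ℂ) = 1 := by
  rw [← Complex.ofReal_mul]
  have h : Real.sqrt 2 * (1 / Real.sqrt 2) = 1 := by
    field_simp
  rw [h, Complex.ofReal_one]

/-- **Even windows on the even basis.** For an even coefficient vector (`c_{−n} = c_n`),
`Σ_{|n| ≤ N} c_n χ_n = Σ_{0 ≤ i ≤ N} ζ_i w⁺_i` with `ζ_0 = c_0`, `ζ_i = √2 c_i` (`i ≥ 1`). -/
theorem sum_modes_smul_chi_of_even (N : ℕ) (c : ℤ → ℂ) (hc : ∀ n, c (-n) = c n) :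
    ∑ n ∈ modes N, c n • chi a n =
      ∑ i ∈ Finset.range (N + 1),
        (if i = 0 then c 0 else ((Real.sqrt 2 : ℝ) : ℂ) * c i) • chiEven a i := by
  induction N with
  | zero =>
    have h0 : modes 0 = {0} := by ext n; simp [mem_modes]
    simp [h0, chiEven]
  | succ N ih =>
    rw [modes_succ, Finset.sum_insert (not_mem_modes_succ_left N),
      Finset.sum_insert (neg_succ_not_mem_modes N), ih, Finset.sum_range_succ _ (N + 1)]
    have hN : (N + 1 : ℕ) ≠ 0 := Nat.succ_ne_zero N
    rw [if_neg hN, hc]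
    have hE : chiEven a (N + 1) = ((1 / Real.sqrt 2 : ℝ) : ℂ) •
        (chi a (((N + 1 : ℕ) : ℤ)) + chi a (-(((N + 1 : ℕ) : ℤ)))) := by
      unfold chiEven
      rw [if_neg hN]
    rw [hE, smul_smul, mul_assoc, mul_comm (c _), ← mul_assoc, sqrt_two_mul_inv_sqrt_two, one_mul,
      smul_add]
    push_cast
    abel

/-- **Odd windows on the odd basis.** For an odd coefficient vector (`c_{−n} = −c_n`),
`Σ_{|n| ≤ N} c_n χ_n = Σ_{1 ≤ i ≤ N} √2 c_i w⁻_i`. -/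
theorem sum_modes_smul_chi_of_odd (N : ℕ) (c : ℤ → ℂ) (hc : ∀ n, c (-n) = -c n) :
    ∑ n ∈ modes N, c n • chi a n =
      ∑ i ∈ Finset.Icc 1 N, (((Real.sqrt 2 : ℝ) : ℂ) * c i) • chiOdd a i := by
  have hc0 : c 0 = 0 := by
    have h := hc 0
    rw [neg_zero] at h
    exact CharZero.eq_neg_self_iff.mp h
  induction N with
  | zero =>
    have h0 : modes 0 = {0} := by ext n; simp [mem_modes]
    simp [h0, hc0]
  | succ N ih =>
    have hIcc : Finset.Icc 1 (N + 1) = insert (N + 1) (Finset.Icc 1 N) := by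
      ext i; simp only [Finset.mem_Icc, Finset.mem_insert]; omega
    have hnot : N + 1 ∉ Finset.Icc 1 N := by simp
    rw [modes_succ, Finset.sum_insert (not_mem_modes_succ_left N),
      Finset.sum_insert (neg_succ_not_mem_modes N), ih, hIcc, Finset.sum_insert hnot, hc]
    unfold chiOdd
    rw [smul_smul, mul_assoc, mul_comm (c _), ← mul_assoc, sqrt_two_mul_inv_sqrt_two, one_mul,
      smul_sub, neg_smul]
    push_cast
    abel

/-! ## Principal sub-blocks: a PSD certificate at size `M` covers every `N ≤ M` -/

/-- The real quadratic form of a principal sub-block is the big form at the zero-extended vector. -/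
theorem sum_sum_mul_eq_of_subset {ι : Type*} [DecidableEq ι] {s t : Finset ι} (hst : s ⊆ t)
    (G : ι → ι → ℝ) (z : ι → ℝ) :
    ∑ i ∈ t, ∑ j ∈ t, (if i ∈ s then z i else 0) * G i j * (if j ∈ s then z j else 0) =
      ∑ i ∈ s, ∑ j ∈ s, z i * G i j * z j := by
  rw [← Finset.sum_subset hst (fun i _ hi ↦ by simp [hi])]
  refine Finset.sum_congr rfl fun i hi ↦ ?_
  rw [← Finset.sum_subset hst (fun j _ hj ↦ by simp [hj])]
  refine Finset.sum_congr rfl fun j hj ↦ ?_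
  simp [hi, hj]

/-- **Principal sub-blocks of a PSD real Gram are PSD**: if `Σ_{i,j ∈ t} y_i G_{ij} y_j ≥ 0` for all
real `y`, then the same holds on every `s ⊆ t`. (So ONE block certificate at size `M` gives the
hypothesis of `weilPositivityOn_of_sectorBasis_real_gram_psd` for every `N ≤ M`; the sizes `N > M`
are the far-coercivity / Schur step.) -/
theorem real_psd_of_subset {ι : Type*} [DecidableEq ι] {s t : Finset ι} (hst : s ⊆ t)
    (G : ι → ι → ℝ) (h : ∀ y : ι → ℝ, 0 ≤ ∑ i ∈ t, ∑ j ∈ t, y i * G i j * y j) (z : ι → ℝ) :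
    0 ≤ ∑ i ∈ s, ∑ j ∈ s, z i * G i j * z j := by
  rw [← sum_sum_mul_eq_of_subset hst G z]
  exact h _

/-! ## The sector-basis dictionary -/

/-- **From REAL PSD certificates of the two sector Gram matrices to a rung.** Let `a > 0`; let the
sector Gram matrices `G⁺(i,j) = weilWindowSesq a w⁺_i w⁺_j` (`i, j ∈ ℕ`) and
`G⁻(i,j) = weilWindowSesq a w⁻_i w⁻_j` have real entries (they do: Yoshida's closed forms (5.13)–(5.16)),
and suppose that for every `N` the real quadratic forms are non-negative:
`Σ_{i,j ≤ N} z_i z_j Re G⁺(i,j) ≥ 0` and `Σ_{1 ≤ i,j ≤ N} z_i z_j Re G⁻(i,j) ≥ 0` for all real `z`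
(e.g. by an exact `LDLᵀ` verdict on the block plus the far-coercivity / Schur step for the quantifier
over `N`). Then `WeilPositivityOn a`. -/
theorem weilPositivityOn_of_sectorBasis_real_gram_psd (ha : 0 < a)
    (hrealE : ∀ i j : ℕ, (weilWindowSesq a (chiEven a i) (chiEven a j)).im = 0)
    (hrealO : ∀ i j : ℕ, (weilWindowSesq a (chiOdd a i) (chiOdd a j)).im = 0)
    (hev : ∀ (N : ℕ) (z : ℕ → ℝ), 0 ≤ ∑ i ∈ Finset.range (N + 1), ∑ j ∈ Finset.range (N + 1),
      z i * (weilWindowSesq a (chiEven a i) (chiEven a j)).re * z j)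
    (hod : ∀ (N : ℕ) (z : ℕ → ℝ), 0 ≤ ∑ i ∈ Finset.Icc 1 N, ∑ j ∈ Finset.Icc 1 N,
      z i * (weilWindowSesq a (chiOdd a i) (chiOdd a j)).re * z j) :
    WeilPositivityOn a := by
  have hev' : ∀ (N : ℕ) (z : ℕ → ℝ), 0 ≤ ∑ i ∈ Finset.range (N + 1), ∑ j ∈ Finset.range (N + 1),
      z i * z j * (weilWindowSesq a (chiEven a i) (chiEven a j)).re := fun N z ↦ by
    simpa only [mul_right_comm] using hev N z
  have hod' : ∀ (N : ℕ) (z : ℕ → ℝ), 0 ≤ ∑ i ∈ Finset.Icc 1 N, ∑ j ∈ Finset.Icc 1 N,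
      z i * z j * (weilWindowSesq a (chiOdd a i) (chiOdd a j)).re := fun N z ↦ by
    simpa only [mul_right_comm] using hod N z
  refine weilPositivityOn_of_sector_nonneg ha (fun N c hc ↦ ?_) (fun N c hc ↦ ?_)
  · rw [sum_modes_smul_chi_of_even N c hc,
      weilWindowForm_sum_smul_eq_re ha.le (Finset.range (N + 1))
        (fun i _ ↦ isWindowFunction_chiEven ha i) _ a]
    exact re_sum_sum_mul_conj_mul_nonneg (Finset.range (N + 1)) (fun i _ j _ ↦ hrealE i j)
      (fun _ ↦ True) (fun z _ ↦ hev' N z) _ trivial trivial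
  · rw [sum_modes_smul_chi_of_odd N c hc,
      weilWindowForm_sum_smul_eq_re ha.le (Finset.Icc 1 N)
        (fun i _ ↦ isWindowFunction_chiOdd ha i) _ a]
    exact re_sum_sum_mul_conj_mul_nonneg (Finset.Icc 1 N) (fun i _ j _ ↦ hrealO i j)
      (fun _ ↦ True) (fun z _ ↦ hod' N z) _ trivial trivial

end Summit.RiemannHypothesis.RiemannHypothesis.Theorems.WeilFormatC

end
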